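import Literature.Computability.Cryptography.SchemesProofs
import Literature.Computability.Cryptography.SignaturesRestrictedOneTime
import Literature.Computability.Complexity.FoldCatBricks
import Literature.Computability.Complexity.IndexAllBricks
import HarnessLib

/-!
# Lamport's length-restricted one-time signature scheme (Goldreich 2004, Construction 6.4.4)

Topic `Literature/Computability/Cryptography`; a brick of the printed proof of Goldreich's
Theorem 6.4.1 (one-way functions ⇒ EUF-CMA-secure signature schemes; the tree's named fact
`secureSignaturesExist_of_OWFExist`, Rompel 1990), which is assembled from Thm. 6.4.29 (UOWHFs),
Thm. 6.4.32 (one-time signatures: Lamport's Construction 6.4.4 / Prop. 6.4.5, then one-time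
hash-and-sign, Construction 6.4.30 / Prop. 6.4.31) and Thm. 6.4.9 (authentication trees,
Constructions 6.4.14 / 6.4.16). The length-restricted notions (Def. 6.4.3:
`SignatureScheme.IsRestrictedCorrect`, `SignatureScheme.restrictedOneTimeForgeProb`,
`SignatureScheme.IsRestrictedOneTimeSecure`) are those of `SignaturesRestrictedOneTime.lean`. This
file vendors, in the tree's machine model (`CommitmentsSignatures.lean`: `SignatureScheme`,
`RandAlg`, the chosen-message experiment `cmaExpPMF`):

* **Construction 6.4.4** — `Lamport.scheme f ℓ`: on `1ⁿ`, `2ℓ(n)` uniform `n`-bit blocks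
  `s₀, …, s_{2ℓ(n)-1}` (block `2i + j` playing `sᵢʲ`), verification key
  `⟨1ⁿ, encList [f s₀, …, f s_{2ℓ(n)-1}]⟩`, signing key `⟨1ⁿ, s₀ ⋯ s_{2ℓ(n)-1}⟩`; the signature of
  `α = σ₀ ⋯ σ_{ℓ(n)-1}` is the concatenation `s_{2·0+σ₀} ⋯ s_{2(ℓ(n)-1)+σ_{ℓ(n)-1}}`; verification
  recomputes `f` on the `ℓ(n)` blocks of the alleged signature. (The book assumes `f`
  length-preserving "for simplicity" and concatenates the images; we keep `f` arbitrary and use the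
  self-delimiting list code `encList` of the images instead — the only deviation.)
* `Lamport.isRestrictedCorrect` — condition 2 of Def. 6.4.3 for the construction;
* `Lamport.isEfficient` — the three algorithms are polynomial-time whenever `f ∈ FP` (programs
  `kgFn`, `sigFn`, `verFn` assembled in the `FP` string algebra — folds `Brick.foldCat` over the
  blocks, the bounded conjunction `Brick.allIdxFn` — with their semantics `kgFn_apply`, `sigFn_apply`,
  `verFn_apply` on EVERY input, as `PolyTimeComputable.of_encode` requires).

Prop. 6.4.5 (security in the sense of `IsRestrictedOneTimeSecure` from the one-wayness of `f`: a
one-time forger is run by an inverter that plants its challenge at a random key position) is the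
subject of the companion file `LamportOTSSecurity.lean`.

## References

* O. Goldreich, *Foundations of Cryptography II: Basic Applications*, CUP 2004, §6.4.1:
  Def. 6.4.2 (security of one-time signature schemes), Def. 6.4.3 (length-restricted one-time
  signature schemes), Construction 6.4.4 and Prop. 6.4.5 (PDF pp. 225–229 of the held copy).
* L. Lamport, *Constructing digital signatures from a one-way function*, SRI Technical Report
  CSL-98, 1979.
-/

namespace Literature.Computability.Cryptography

open Filter Asymptotics _root_.Computability Complexity Finset Polynomial
open Complexity.Brick

/-! ### Lamport's construction (Construction 6.4.4) -/

namespace Lamport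

variable (f : List Bool → List Bool) (ℓ : Polynomial ℕ)

/-- The images `vₜ = f(sₜ)` of the `2ℓ(n)` key blocks `sₜ = blk n t r` (block `2i + j` is the
book's `sᵢʲ`). [Goldreich 2004, Construction 6.4.4 (key generation)] [cite: Goldreich2004, Construction 6.4.4] -/
def images (n : ℕ) (r : List Bool) : List (List Bool) :=
  (List.range (2 * ℓ.eval n)).map fun t => f (Yao.blk n t r)

/-- The verification key `v = ⟨1ⁿ, encList [v₀, …, v_{2ℓ(n)-1}]⟩`. [Goldreich 2004, Construction 6.4.4]
[cite: Goldreich2004, Construction 6.4.4] -/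
def pkOf (n : ℕ) (r : List Bool) : List Bool := boolPair (ones n) (encList (images f ℓ n r))

/-- The signing key `s = ⟨1ⁿ, s₀ ⋯ s_{2ℓ(n)-1}⟩` (the key-generation coins, tagged with `1ⁿ`).
[Goldreich 2004, Construction 6.4.4] [cite: Goldreich2004, Construction 6.4.4] -/
def skOf (n : ℕ) (r : List Bool) : List Bool := boolPair (ones n) r

/-- The block selected by bit `t` of the message: `2t + σₜ`. [Goldreich 2004, Construction 6.4.4
(signing: `sₜ^{σₜ}`)] [cite: Goldreich2004, Construction 6.4.4] -/
def bitIdx (m : List Bool) (t : ℕ) : ℕ := 2 * t + (m.getD t false).toNat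

/-- The signature of `α = σ₀ ⋯ σ_{ℓ(n)-1}` under `s = ⟨1ⁿ, r⟩`: the concatenation of the blocks
`s_{2t+σₜ}`, `t < ℓ(n)`; the empty string on messages of the wrong length. [Goldreich 2004,
Construction 6.4.4 (signing)] [cite: Goldreich2004, Construction 6.4.4] -/
def sigOf (sk m : List Bool) : List Bool :=
  if m.length = ℓ.eval (fstF sk).length then
    ccat (fun t => Yao.blk (fstF sk).length (bitIdx m t) (sndF sk)) (ℓ.eval (fstF sk).length)
  else []

/-- Item `k` of a nested-pair list code (total: `fstF (sndF^k V)`). [folklore] -/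
def itemOf (k : ℕ) (V : List Bool) : List Bool := fstF (sndF^[k] V)

/-- Verification of `(α, β)` under `v = ⟨1ⁿ, V⟩`: `|α| = ℓ(n)`, `|β| = ℓ(n)·n`, and
`f(βₜ) = v_{2t+σₜ}` for every `t < ℓ(n)`. [Goldreich 2004, Construction 6.4.4 (verification)]
[cite: Goldreich2004, Construction 6.4.4] -/
def verifyOf (pk m σ : List Bool) : Bool :=
  decide (m.length = ℓ.eval (fstF pk).length) &&
    (decide (σ.length = ℓ.eval (fstF pk).length * (fstF pk).length) &&
      decide (∀ i < m.length, f (Yao.blk (fstF pk).length i σ) = itemOf (bitIdx m i) (sndF pk)))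

/-- **Construction 6.4.4** as a `SignatureScheme`: key generation with `2ℓ(n)·n` coins, deterministic
signing, deterministic verification. [Goldreich 2004, Construction 6.4.4] [cite: Goldreich2004, Construction 6.4.4] -/
def scheme : SignatureScheme where
  keyGen := ⟨fun n r => (pkOf f ℓ n r, skOf n r), fun n => 2 * ℓ.eval n * n⟩
  sign := ⟨fun p _ => sigOf ℓ p.1 p.2, fun _ => 0⟩
  verify := verifyOf f ℓ

/-! ### Elementary facts on blocks, concatenations and list items -/

/-- A concatenation of `k` pieces of length `n` has length `k·n`. [folklore] -/
theorem length_ccat_of_eq {g : ℕ → List Bool} {n : ℕ} :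
    ∀ {k : ℕ}, (∀ t < k, (g t).length = n) → (ccat g k).length = k * n
  | 0, _ => by simp
  | k + 1, h => by
    rw [ccat_succ, List.length_append, length_ccat_of_eq (fun t ht => h t (by omega)), h k (by omega)]
    ring

/-- Block `i` of a concatenation of pieces of length `n` is piece `i`. [folklore] -/
theorem blk_ccat_of_eq {g : ℕ → List Bool} {n : ℕ} :
    ∀ {k : ℕ}, (∀ t < k, (g t).length = n) → ∀ {i : ℕ}, i < k → Yao.blk n i (ccat g k) = g i
  | 0, _, _, hi => absurd hi (Nat.not_lt_zero _)
  | k + 1, h, i, hi => by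
    have h' : ∀ t < k, (g t).length = n := fun t ht => h t (by omega)
    have hL : (ccat g k).length = k * n := length_ccat_of_eq h'
    rw [ccat_succ, Yao.blk_eq_take_drop]
    rcases Nat.lt_succ_iff_lt_or_eq.1 hi with hlt | rfl
    · have hle : (i + 1) * n ≤ k * n := Nat.mul_le_mul_right n hlt
      rw [List.drop_append_of_le_length (by rw [hL]; exact le_trans (by nlinarith) hle),
        List.take_append_of_le_length (by rw [List.length_drop, hL, Nat.succ_mul] at *; omega),
        ← Yao.blk_eq_take_drop, blk_ccat_of_eq h' hlt]
    · rw [List.drop_append_of_le_length (by rw [hL]), List.drop_eq_nil_of_le (by rw [hL]),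
        List.nil_append, List.take_of_length_le (h i (by omega)).le]

/-- `itemOf k (encList l) = l[k]` (default `[]`). [folklore] -/
theorem itemOf_encList (k : ℕ) (l : List (List Bool)) : itemOf k (encList l) = l.getD k [] := by
  induction l generalizing k with
  | nil =>
    induction k with
    | zero => rfl
    | succ k ih => simp [itemOf, Function.iterate_succ_apply] at ih ⊢
  | cons a l ih =>
    cases k with
    | zero => simp [itemOf, encList_cons]
    | succ k => simpa [itemOf, encList_cons, Function.iterate_succ_apply] using ih k

/-- The key blocks have length `n` (for coins of the prescribed length). [folklore] -/
theorem length_blk_key {n t : ℕ} {r : List Bool} (hr : r.length = 2 * ℓ.eval n * n)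
    (ht : t < 2 * ℓ.eval n) : (Yao.blk n t r).length = n :=
  Yao.length_blk_of_le (by rw [hr]; exact Nat.mul_le_mul_right n ht)

/-- `bitIdx m t < 2ℓ(n)` for `t < ℓ(n)`. [folklore] -/
theorem bitIdx_lt {m : List Bool} {t L : ℕ} (ht : t < L) : bitIdx m t < 2 * L := by
  unfold bitIdx; cases m.getD t false <;> simp <;> omega

/-! ### Restricted correctness (Def. 6.4.3 (2)) -/

/-- The support of the key law: honest keys `(pkOf n r, skOf n r)` with `|r| = 2ℓ(n)·n`. [folklore] -/
theorem exists_of_mem_support_keyPMF {n : ℕ} {ks : List Bool × List Bool}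
    (h : ks ∈ ((scheme f ℓ).keyPMF n).support) :
    ∃ r : List Bool, r.length = 2 * ℓ.eval n * n ∧ ks = (pkOf f ℓ n r, skOf n r) := by
  rw [SignatureScheme.keyPMF, RandAlg.outputPMF, PMF.support_map] at h
  obtain ⟨v, -, rfl⟩ := h
  refine ⟨v.toList, ?_, rfl⟩
  rw [v.toList_length]
  show (scheme f ℓ).keyGen.coinLen (unaryEncodeNat n).length = _
  rw [Complexity.unaryEncodeNat_eq_replicate, List.length_replicate]
  rfl

/-- The support of the (deterministic) signing law: the single signature `sigOf sk m`. [folklore] -/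
theorem eq_of_mem_support_sigPMF {sk m σ : List Bool} (h : σ ∈ ((scheme f ℓ).sigPMF sk m).support) :
    σ = sigOf ℓ sk m := by
  rw [SignatureScheme.sigPMF, RandAlg.outputPMF, PMF.support_map] at h
  obtain ⟨_, -, rfl⟩ := h
  rfl

/-- The signature of a message of the right length under an honest key. [Goldreich 2004, Construction 6.4.4]
[cite: Goldreich2004, Construction 6.4.4] -/
theorem sigOf_skOf {n : ℕ} (r m : List Bool) (hm : m.length = ℓ.eval n) :
    sigOf ℓ (skOf n r) m = ccat (fun t => Yao.blk n (bitIdx m t) r) (ℓ.eval n) := by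
  simp [sigOf, skOf, hm]

/-- Under an honest key, item `bitIdx m t` of the verification key is `f` of the corresponding key
block. [Goldreich 2004, Construction 6.4.4] [cite: Goldreich2004, Construction 6.4.4] -/
theorem itemOf_pkOf {n k : ℕ} (r : List Bool) (hk : k < 2 * ℓ.eval n) :
    itemOf k (sndF (pkOf f ℓ n r)) = f (Yao.blk n k r) := by
  rw [pkOf, sndF_boolPair, itemOf_encList, images, List.getD_eq_getElem?_getD, List.getElem?_map,
    List.getElem?_range hk]
  rfl

/-- **Restricted correctness of Construction 6.4.4**: honest signatures of `ℓ(n)`-bit messages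
verify. [Goldreich 2004, Construction 6.4.4 with Def. 6.4.3 (2)] [cite: Goldreich2004, Construction 6.4.4] -/
theorem isRestrictedCorrect : (scheme f ℓ).IsRestrictedCorrect fun n => ℓ.eval n := by
  intro n ks hks m hm σ hσ
  obtain ⟨r, hr, rfl⟩ := exists_of_mem_support_keyPMF f ℓ hks
  have hσ' := eq_of_mem_support_sigPMF f ℓ hσ
  dsimp only at hσ' hm
  subst hσ'
  rw [sigOf_skOf ℓ r m hm]
  have hlen : ∀ t < ℓ.eval n, (Yao.blk n (bitIdx m t) r).length = n := fun t ht =>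
    length_blk_key ℓ hr (bitIdx_lt ht)
  have hn : (fstF (pkOf f ℓ n r)).length = n := by simp [pkOf]
  show verifyOf f ℓ (pkOf f ℓ n r) m _ = true
  simp only [verifyOf, hn, hm, length_ccat_of_eq hlen, decide_true, Bool.true_and, decide_eq_true_eq]
  intro i hi
  rw [blk_ccat_of_eq hlen hi, itemOf_pkOf f ℓ r (bitIdx_lt hi)]

/-! ### The three algorithms as `FP` string functions (Construction 6.4.4 is a triple of PPT algorithms)

Brick assembly in the `FP` string algebra (`BrickAlgebra.lean`, `PlumbingBricks.lean`,
`FoldCatBricks.lean`, `IndexAllBricks.lean`); no machine is programmed. -/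

section Programs

open Complexity.Plumb Complexity.OracleCompose Complexity.HashBricks

/-- `unaryEncodeNat a = 1ᵇ ↔ a = b`. [folklore] -/
theorem unary_eq_ones_iff {a b : ℕ} : unaryEncodeNat a = ones b ↔ a = b := by
  rw [Complexity.unaryEncodeNat_eq_replicate]
  exact ⟨fun h => by simpa using congrArg List.length h, fun h => h ▸ rfl⟩

/-- `1ᵗ ++ 1ᵗ`, doubled index in unary: `⟨·, 1ᵗ⟩ ↦ 1^{2t}`. [folklore] -/
noncomputable def dblFn : List Bool → List Bool := concatFn ∘ fanoutFn sndF sndF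

/-- `dblFn ⟨x, v⟩ = v ++ v`. [folklore] -/
@[simp] theorem dblFn_boolPair (x v : List Bool) : dblFn (boolPair x v) = v ++ v := by
  simp [dblFn]

/-- `dblFn ∈ FP`. [folklore] -/
theorem dblFn_mem_FP : dblFn ∈ FP := comp_mem_FP concatFn_mem_FP (fanoutFn_mem_FP sndF_mem_FP sndF_mem_FP)

/-- The selected index in unary, from a one-bit selector `c`: `1^{2t + [c]}` on `⟨x, 1ᵗ⟩`. [folklore] -/
noncomputable def selIdxFn (c : List Bool → List Bool) : List Bool → List Bool :=
  iteFn c (List.cons true ∘ dblFn) dblFn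

/-- `selIdxFn c ⟨x, 1ᵗ⟩ = 1^{2t + b}` when `c ⟨x, 1ᵗ⟩ = [b]`. [folklore] -/
theorem selIdxFn_apply {c : List Bool → List Bool} {x : List Bool} {t : ℕ} {b : Bool}
    (h : c (boolPair x (ones t)) = [b]) : selIdxFn c (boolPair x (ones t)) = ones (2 * t + b.toNat) := by
  rw [selIdxFn, iteFn_apply h]
  cases b
  · simp only [Bool.false_eq_true, if_false, dblFn_boolPair, Bool.toNat_false, Nat.add_zero, ones]
    rw [two_mul, List.replicate_add]
  · simp only [if_true, Function.comp_apply, dblFn_boolPair, Bool.toNat_true, ones]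
    rw [show 2 * t + 1 = 1 + (t + t) by ring, List.replicate_add, List.replicate_add]
    rfl

/-- `selIdxFn c ∈ FP` for `c ∈ FP`. [folklore] -/
theorem selIdxFn_mem_FP {c : List Bool → List Bool} (hc : c ∈ FP) : selIdxFn c ∈ FP :=
  iteFn_mem_FP hc (comp_mem_FP (cons_mem_FP true) dblFn_mem_FP) dblFn_mem_FP

/-- Block extraction: `⟨1ⁿ', ⟨1ʲ, w⟩⟩ ↦ blk n' j w = (w ⇂ j n') ↾ n'`. [folklore] -/
noncomputable def blkFn : List Bool → List Bool :=
  takeFn ∘ fanoutFn fstF (dropFn ∘ fanoutFn (umulFn ∘ fanoutFn (nthF 1) fstF) (sndPow 1))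

/-- `blkFn ⟨1ⁿ', ⟨1ʲ, w⟩⟩ = blk n' j w` (any `u`, `v` of lengths `n'`, `j`). [folklore] -/
@[simp] theorem blkFn_apply (u v w : List Bool) :
    blkFn (boolPair u (boolPair v w)) = Yao.blk u.length v.length w := by
  simp [blkFn, umulFn_apply, Yao.blk_eq_take_drop]

/-- `blkFn ∈ FP`. [folklore] -/
theorem blkFn_mem_FP : blkFn ∈ FP :=
  comp_mem_FP takeFn_mem_FP (fanoutFn_mem_FP fstF_mem_FP (comp_mem_FP dropFn_mem_FP
    (fanoutFn_mem_FP (comp_mem_FP umulFn_mem_FP (fanoutFn_mem_FP (nthF_mem_FP 1) fstF_mem_FP))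
      (sndPow_mem_FP 1))))

/-! #### Key generation -/

/-- Piece `t` of the verification key: the frame `⟨f (blk n t r), ε⟩`, on `⟨⟨1ⁿ, r⟩, 1ᵗ⟩`. [folklore] -/
noncomputable def pieceK : List Bool → List Bool :=
  fanoutFn (f ∘ blkFn ∘ fanoutFn (fstF ∘ fstF) (fanoutFn sndF (sndF ∘ fstF))) fun _ => []

/-- `pieceK ⟨⟨u, r⟩, v⟩ = ⟨f (blk |u| |v| r), ε⟩`. [folklore] -/
@[simp] theorem pieceK_apply (u r v : List Bool) :
    pieceK f (boolPair (boolPair u r) v) = boolPair (f (Yao.blk u.length v.length r)) [] := by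
  simp [pieceK]

/-- `pieceK ∈ FP` for `f ∈ FP`. [folklore] -/
theorem pieceK_mem_FP (hf : f ∈ FP) : pieceK f ∈ FP :=
  fanoutFn_mem_FP (comp_mem_FP hf (comp_mem_FP blkFn_mem_FP (fanoutFn_mem_FP (comp_mem_FP fstF_mem_FP fstF_mem_FP)
    (fanoutFn_mem_FP sndF_mem_FP (comp_mem_FP sndF_mem_FP fstF_mem_FP))))) (const_mem_FP [])

/-- Key generation as a string function: `z = ⟨1ⁿ, r⟩ ↦ ⟨⟨1ⁿ, encList images⟩, z⟩ = ⟨pk, sk⟩`;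
`Q` is the clip of the fold (a bound `2 p_f + 2` on the pieces). [Goldreich 2004, Construction 6.4.4]
[cite: Goldreich2004, Construction 6.4.4] -/
noncomputable def kgFn (Q : Polynomial ℕ) : List Bool → List Bool :=
  fanoutFn (fanoutFn fstF (foldCat Q (2 * ℓ) (pieceK f) ∘ fanoutFn id (polyFn (2 * ℓ) ∘ fstF))) id

/-- `kgFn ∈ FP` for `f ∈ FP`. [cite: AroraBarak2009, §1.3 (bounded loops)] -/
theorem kgFn_mem_FP (hf : f ∈ FP) (Q : Polynomial ℕ) : kgFn f ℓ Q ∈ FP :=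
  fanoutFn_mem_FP (fanoutFn_mem_FP fstF_mem_FP (comp_mem_FP (foldCat_mem_FP Q _ (pieceK_mem_FP f hf))
    (fanoutFn_mem_FP id_mem_FP (comp_mem_FP (polyFn_mem_FP _) fstF_mem_FP)))) id_mem_FP

/-- **Semantics of `kgFn`**: with a clip `Q` dominating `2|f w| + 2` on blocks, `kgFn ⟨1ⁿ, r⟩ = ⟨pkOf n r, skOf n r⟩`.
[Goldreich 2004, Construction 6.4.4] [cite: Goldreich2004, Construction 6.4.4] -/
theorem kgFn_apply {Q : Polynomial ℕ} (hQ : ∀ w : List Bool, 2 * (f w).length + 2 ≤ Q.eval w.length)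
    (hQm : ∀ a b, a ≤ b → Q.eval a ≤ Q.eval b) (n : ℕ) (r : List Bool) :
    kgFn f ℓ Q (boolPair (ones n) r) = boolPair (pkOf f ℓ n r) (skOf n r) := by
  have hx : n ≤ (boolPair (ones n) r).length := by simp [length_boolPair]; omega
  have hfold : foldCat Q (2 * ℓ) (pieceK f) (boolPair (boolPair (ones n) r) (ones ((2 * ℓ).eval n))) =
      encList (images f ℓ n r) := by
    rw [foldCat_apply]
    · simp only [List.length_replicate, pieceK_apply]
      rw [ccat_frame_eq_encList, images, eval_mul, eval_ofNat]
    · rw [List.length_replicate]; exact natPoly_eval_mono _ hx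
    · intro t _
      rw [pieceK_apply, length_boolPair, List.length_nil, Nat.add_zero]
      refine (hQ _).trans (hQm _ _ ((Yao.length_blk_le _ _ _).trans ?_))
      simpa using hx
  simp only [kgFn, fanoutFn_apply, fstF_boolPair, Function.comp_apply, id, polyFn_apply, List.length_replicate,
    hfold]
  rfl

/-! #### Signing -/

/-- Bit `t` of the message, on `⟨⟨sk, m⟩, 1ᵗ⟩`. [folklore] -/
noncomputable def bitFnS : List Bool → List Bool := headBitFn ∘ dropFn ∘ fanoutFn sndF (sndF ∘ fstF)

/-- `bitFnS ⟨⟨sk, m⟩, 1ᵗ⟩ = [m_t]`. [folklore] -/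
@[simp] theorem bitFnS_apply (sk m : List Bool) (t : ℕ) :
    bitFnS (boolPair (boolPair sk m) (ones t)) = [m.getD t false] := by
  simp [bitFnS]

/-- `bitFnS ∈ FP`. [folklore] -/
theorem bitFnS_mem_FP : bitFnS ∈ FP :=
  comp_mem_FP headBitFn_mem_FP (comp_mem_FP dropFn_mem_FP (fanoutFn_mem_FP sndF_mem_FP (comp_mem_FP sndF_mem_FP fstF_mem_FP)))

/-- Piece `t` of the signature: the block `s_{2t+σₜ}`, on `⟨⟨⟨1ⁿ, r⟩, m⟩, 1ᵗ⟩`. [Goldreich 2004, Construction 6.4.4]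
[cite: Goldreich2004, Construction 6.4.4] -/
noncomputable def pieceS : List Bool → List Bool :=
  blkFn ∘ fanoutFn (fstF ∘ fstF ∘ fstF) (fanoutFn (selIdxFn bitFnS) (sndF ∘ fstF ∘ fstF))

/-- `pieceS ⟨⟨sk, m⟩, 1ᵗ⟩ = blk |fstF sk| (bitIdx m t) (sndF sk)` (every `sk`). [folklore] -/
@[simp] theorem pieceS_apply (sk m : List Bool) (t : ℕ) :
    pieceS (boolPair (boolPair sk m) (ones t)) = Yao.blk (fstF sk).length (bitIdx m t) (sndF sk) := by
  simp only [pieceS, Function.comp_apply, fanoutFn_apply, fstF_boolPair,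
    selIdxFn_apply (bitFnS_apply sk m t), blkFn_apply, List.length_replicate, bitIdx]

/-- `pieceS ∈ FP`. [folklore] -/
theorem pieceS_mem_FP : pieceS ∈ FP :=
  comp_mem_FP blkFn_mem_FP (fanoutFn_mem_FP (comp_mem_FP fstF_mem_FP (comp_mem_FP fstF_mem_FP fstF_mem_FP))
    (fanoutFn_mem_FP (selIdxFn_mem_FP bitFnS_mem_FP) (comp_mem_FP sndF_mem_FP (comp_mem_FP fstF_mem_FP fstF_mem_FP))))

/-- The message-length test `[|m| = ℓ(n)]` on `⟨sk, m⟩` (`n = |fstF sk|`). [Goldreich 2004, Def. 6.4.3]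
[cite: Goldreich2004, Def. 6.4.3] -/
noncomputable def lenOkS : List Bool → List Bool := eqPairFn ∘ fanoutFn (onesFn ∘ sndF) (polyFn ℓ ∘ fstF ∘ fstF)

/-- `lenOkS ⟨sk, m⟩ = [|m| = ℓ(|fstF sk|)]`. [folklore] -/
@[simp] theorem lenOkS_apply (sk m : List Bool) :
    lenOkS ℓ (boolPair sk m) = [decide (m.length = ℓ.eval (fstF sk).length)] := by
  simp only [lenOkS, Function.comp_apply, fanoutFn_apply, sndF_boolPair, fstF_boolPair, eqPairFn_boolPair, onesFn,
    polyFn_apply, unary_eq_ones_iff]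

/-- `lenOkS ∈ FP`. [folklore] -/
theorem lenOkS_mem_FP : lenOkS ℓ ∈ FP :=
  comp_mem_FP eqPairFn_mem_FP (fanoutFn_mem_FP (comp_mem_FP onesFn_mem_FP sndF_mem_FP)
    (comp_mem_FP (polyFn_mem_FP ℓ) (comp_mem_FP fstF_mem_FP fstF_mem_FP)))

/-- Signing as a string function on `x = ⟨sk, m⟩`: if the length test passes, fold the `|m|` pieces,
else `ε`. [Goldreich 2004, Construction 6.4.4 (signing)] [cite: Goldreich2004, Construction 6.4.4] -/
noncomputable def sigFn : List Bool → List Bool :=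
  iteFn (lenOkS ℓ) (foldCat X X pieceS ∘ fanoutFn id sndF) fun _ => []

/-- `sigFn ∈ FP`. [cite: AroraBarak2009, §1.3 (bounded loops)] -/
theorem sigFn_mem_FP : sigFn ℓ ∈ FP :=
  iteFn_mem_FP (lenOkS_mem_FP ℓ) (comp_mem_FP (foldCat_mem_FP X X pieceS_mem_FP) (fanoutFn_mem_FP id_mem_FP sndF_mem_FP))
    (const_mem_FP [])

/-- **Semantics of `sigFn`**: `sigFn ⟨sk, m⟩ = sigOf sk m` for EVERY `sk`, `m`. [Goldreich 2004, Construction 6.4.4]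
[cite: Goldreich2004, Construction 6.4.4] -/
theorem sigFn_apply (sk m : List Bool) : sigFn ℓ (boolPair sk m) = sigOf ℓ sk m := by
  unfold sigFn sigOf
  by_cases hm : m.length = ℓ.eval (fstF sk).length
  · rw [iteFn_apply_true (by rw [lenOkS_apply, decide_eq_true hm]), if_pos hm, Function.comp_apply, fanoutFn_apply,
      sndF_boolPair, id, foldCat_apply, hm]
    · exact ccat_congr fun t _ => pieceS_apply sk m t
    · rw [eval_X, length_boolPair]; omega
    · intro t _
      rw [pieceS_apply, eval_X, length_boolPair]
      have h1 := Yao.length_blk_le (fstF sk).length (bitIdx m t) (sndF sk)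
      have h2 := length_fstF_sndF_le sk
      omega
  · rw [iteFn_apply_false (by rw [lenOkS_apply]; simp [hm]), if_neg hm]

/-! #### Verification -/

/-- Bit `i` of the message, on `⟨⟨pk, ⟨m, σ⟩⟩, 1ⁱ⟩`. [folklore] -/
noncomputable def bitFnV : List Bool → List Bool := headBitFn ∘ dropFn ∘ fanoutFn sndF (nthF 1 ∘ fstF)

/-- `bitFnV ⟨⟨pk, ⟨m, σ⟩⟩, 1ⁱ⟩ = [m_i]`. [folklore] -/
@[simp] theorem bitFnV_apply (pk m σ : List Bool) (i : ℕ) :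
    bitFnV (boolPair (boolPair pk (boolPair m σ)) (ones i)) = [m.getD i false] := by
  simp [bitFnV]

/-- `bitFnV ∈ FP`. [folklore] -/
theorem bitFnV_mem_FP : bitFnV ∈ FP :=
  comp_mem_FP headBitFn_mem_FP (comp_mem_FP dropFn_mem_FP (fanoutFn_mem_FP sndF_mem_FP (comp_mem_FP (nthF_mem_FP 1) fstF_mem_FP)))

/-- Block `i` of the alleged signature, on `⟨⟨pk, ⟨m, σ⟩⟩, 1ⁱ⟩` (`n = |fstF pk|`). [folklore] -/
noncomputable def sigBlkFn : List Bool → List Bool :=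
  blkFn ∘ fanoutFn (fstF ∘ fstF ∘ fstF) (fanoutFn sndF (sndPow 1 ∘ fstF))

/-- `sigBlkFn ⟨⟨pk, ⟨m, σ⟩⟩, 1ⁱ⟩ = blk |fstF pk| i σ`. [folklore] -/
@[simp] theorem sigBlkFn_apply (pk m σ : List Bool) (i : ℕ) :
    sigBlkFn (boolPair (boolPair pk (boolPair m σ)) (ones i)) = Yao.blk (fstF pk).length i σ := by
  simp [sigBlkFn]

/-- `sigBlkFn ∈ FP`. [folklore] -/
theorem sigBlkFn_mem_FP : sigBlkFn ∈ FP :=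
  comp_mem_FP blkFn_mem_FP (fanoutFn_mem_FP (comp_mem_FP fstF_mem_FP (comp_mem_FP fstF_mem_FP fstF_mem_FP))
    (fanoutFn_mem_FP sndF_mem_FP (comp_mem_FP (sndPow_mem_FP 1) fstF_mem_FP)))

/-- The key item `v_{2i+σᵢ}`, on `⟨⟨pk, ⟨m, σ⟩⟩, 1ⁱ⟩`. [folklore] -/
noncomputable def itemFnV : List Bool → List Bool :=
  nthItemFn ∘ fanoutFn (selIdxFn bitFnV) (sndF ∘ fstF ∘ fstF)

/-- `itemFnV ⟨⟨pk, ⟨m, σ⟩⟩, 1ⁱ⟩ = itemOf (bitIdx m i) (sndF pk)`. [folklore] -/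
@[simp] theorem itemFnV_apply (pk m σ : List Bool) (i : ℕ) :
    itemFnV (boolPair (boolPair pk (boolPair m σ)) (ones i)) = itemOf (bitIdx m i) (sndF pk) := by
  simp only [itemFnV, Function.comp_apply, fanoutFn_apply, selIdxFn_apply (bitFnV_apply pk m σ i), fstF_boolPair,
    nthItemFn_boolPair, List.length_replicate, itemOf, bitIdx]

/-- `itemFnV ∈ FP`. [folklore] -/
theorem itemFnV_mem_FP : itemFnV ∈ FP :=
  comp_mem_FP nthItemFn_mem_FP (fanoutFn_mem_FP (selIdxFn_mem_FP bitFnV_mem_FP)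
    (comp_mem_FP sndF_mem_FP (comp_mem_FP fstF_mem_FP fstF_mem_FP)))

/-- The test of position `i`: `[f(βᵢ) = v_{2i+σᵢ}]`. [Goldreich 2004, Construction 6.4.4 (verification)]
[cite: Goldreich2004, Construction 6.4.4] -/
noncomputable def pieceV : List Bool → List Bool := eqPairFn ∘ fanoutFn (f ∘ sigBlkFn) itemFnV

/-- `pieceV` on a round record. [folklore] -/
@[simp] theorem pieceV_apply (pk m σ : List Bool) (i : ℕ) :
    pieceV f (boolPair (boolPair pk (boolPair m σ)) (ones i)) =
      [decide (f (Yao.blk (fstF pk).length i σ) = itemOf (bitIdx m i) (sndF pk))] := by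
  simp only [pieceV, Function.comp_apply, fanoutFn_apply, sigBlkFn_apply, itemFnV_apply, eqPairFn_boolPair]

/-- `pieceV` is a one-bit test. [folklore] -/
theorem oneBit_pieceV : OneBit (pieceV f) := fun z => by
  simp only [pieceV, Function.comp_apply, fanoutFn_apply, eqPairFn_boolPair]
  exact ⟨_, rfl⟩

/-- `pieceV ∈ FP` for `f ∈ FP`. [folklore] -/
theorem pieceV_mem_FP (hf : f ∈ FP) : pieceV f ∈ FP :=
  comp_mem_FP eqPairFn_mem_FP (fanoutFn_mem_FP (comp_mem_FP hf sigBlkFn_mem_FP) itemFnV_mem_FP)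

/-- The message-length test `[|m| = ℓ(n)]` on `⟨pk, ⟨m, σ⟩⟩`. [Goldreich 2004, Def. 6.4.3] [cite: Goldreich2004, Def. 6.4.3] -/
noncomputable def lenOkV1 : List Bool → List Bool := eqPairFn ∘ fanoutFn (onesFn ∘ nthF 1) (polyFn ℓ ∘ fstF ∘ fstF)

/-- `lenOkV1 ⟨pk, ⟨m, σ⟩⟩ = [|m| = ℓ(|fstF pk|)]`. [folklore] -/
@[simp] theorem lenOkV1_apply (pk m σ : List Bool) :
    lenOkV1 ℓ (boolPair pk (boolPair m σ)) = [decide (m.length = ℓ.eval (fstF pk).length)] := by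
  simp only [lenOkV1, Function.comp_apply, fanoutFn_apply, nthF_succ_boolPair, nthF_zero_boolPair, fstF_boolPair,
    eqPairFn_boolPair, onesFn, polyFn_apply, unary_eq_ones_iff]

/-- The signature-length test `[|σ| = ℓ(n)·n]` on `⟨pk, ⟨m, σ⟩⟩`. [Goldreich 2004, Construction 6.4.4]
[cite: Goldreich2004, Construction 6.4.4] -/
noncomputable def lenOkV2 : List Bool → List Bool :=
  eqPairFn ∘ fanoutFn (onesFn ∘ sndPow 1) (umulFn ∘ fanoutFn (polyFn ℓ ∘ fstF ∘ fstF) (fstF ∘ fstF))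

/-- `lenOkV2 ⟨pk, ⟨m, σ⟩⟩ = [|σ| = ℓ(|fstF pk|)·|fstF pk|]`. [folklore] -/
@[simp] theorem lenOkV2_apply (pk m σ : List Bool) :
    lenOkV2 ℓ (boolPair pk (boolPair m σ)) = [decide (σ.length = ℓ.eval (fstF pk).length * (fstF pk).length)] := by
  simp only [lenOkV2, Function.comp_apply, fanoutFn_apply, sndPow_succ_boolPair, sndPow_zero_boolPair, sndF_boolPair,
    fstF_boolPair, umulFn_apply, polyFn_apply, List.length_replicate, eqPairFn_boolPair, onesFn, unary_eq_ones_iff]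

/-- Verification as a string function on `⟨pk, ⟨m, σ⟩⟩`: the conjunction of the two length tests and of
the `|m|` position tests (`allIdxFn` with yardstick `m`). [Goldreich 2004, Construction 6.4.4 (verification)]
[cite: Goldreich2004, Construction 6.4.4] -/
noncomputable def verFn : List Bool → List Bool :=
  andFn (lenOkV1 ℓ) (andFn (lenOkV2 ℓ) (allIdxFn (nthF 1) (pieceV f)))

/-- `verFn ∈ FP` for `f ∈ FP`. [cite: AroraBarak2009, §1.3 (bounded loops)] -/
theorem verFn_mem_FP (hf : f ∈ FP) : verFn f ℓ ∈ FP :=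
  andFn_mem_FP (comp_mem_FP eqPairFn_mem_FP (fanoutFn_mem_FP (comp_mem_FP onesFn_mem_FP (nthF_mem_FP 1))
      (comp_mem_FP (polyFn_mem_FP ℓ) (comp_mem_FP fstF_mem_FP fstF_mem_FP))))
    (andFn_mem_FP (comp_mem_FP eqPairFn_mem_FP (fanoutFn_mem_FP (comp_mem_FP onesFn_mem_FP (sndPow_mem_FP 1))
      (comp_mem_FP umulFn_mem_FP (fanoutFn_mem_FP (comp_mem_FP (polyFn_mem_FP ℓ) (comp_mem_FP fstF_mem_FP fstF_mem_FP))
        (comp_mem_FP fstF_mem_FP fstF_mem_FP)))))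
      (allIdxFn_mem_FP (nthF_mem_FP 1) (pieceV_mem_FP f hf) (oneBit_pieceV f)))

/-- **Semantics of `verFn`**: `verFn ⟨pk, ⟨m, σ⟩⟩ = [verifyOf pk m σ]` for EVERY `pk`, `m`, `σ`.
[Goldreich 2004, Construction 6.4.4] [cite: Goldreich2004, Construction 6.4.4] -/
theorem verFn_apply (pk m σ : List Bool) : verFn f ℓ (boolPair pk (boolPair m σ)) = [verifyOf f ℓ pk m σ] := by
  have hall := allIdxFn_apply (h := nthF 1) (oneBit_pieceV f) (u := boolPair pk (boolPair m σ))
    (length_nthF_le 1 _)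
  simp only [nthF_succ_boolPair, nthF_zero_boolPair, pieceV_apply, List.cons.injEq, and_true,
    decide_eq_true_eq] at hall
  rw [verFn, andFn_apply (lenOkV1_apply ℓ pk m σ) (andFn_apply (lenOkV2_apply ℓ pk m σ) hall), verifyOf]

/-! ### Efficiency: Construction 6.4.4 is a triple of polynomial-time algorithms -/

/-- Key generation is PPT (for `f ∈ FP`): the program `kgFn` with clip `2 p_f + 2`, and the coin budget
`2ℓ(n)·n`. [Goldreich 2004, Construction 6.4.4; Arora–Barak 2009, §1.3] [cite: Goldreich2004, Construction 6.4.4] -/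
theorem keyGen_isPolyTime (hf : f ∈ FP) : (scheme f ℓ).keyGen.IsPolyTime unaryEncodeNat pairCode := by
  obtain ⟨pf, hpf⟩ := exists_poly_length_le_of_mem_FP hf
  refine ⟨?_, 2 * ℓ * X, fun n => ?_⟩
  · refine PolyTimeComputable.of_encode (kgFn_mem_FP f ℓ hf (C 2 * pf + C 2))
      (fun p : ℕ × List Bool => boolPair (unaryEncodeNat p.1) p.2) (fun _ => rfl) fun p => ?_
    show kgFn f ℓ (C 2 * pf + C 2) (boolPair (unaryEncodeNat p.1) p.2) = boolPair (pkOf f ℓ p.1 p.2) (skOf p.1 p.2)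
    rw [Complexity.unaryEncodeNat_eq_replicate]
    refine kgFn_apply f ℓ (fun w => ?_) (fun a b h => natPoly_eval_mono _ h) p.1 p.2
    have := hpf w
    simp only [eval_add, eval_mul, eval_C]
    omega
  · show 2 * ℓ.eval n * n ≤ (2 * ℓ * X).eval n
    simp [eval_mul]

/-- Signing is PPT (no coins): the program `sigFn ∘ fstF`. [Goldreich 2004, Construction 6.4.4; Arora–Barak 2009, §1.3]
[cite: Goldreich2004, Construction 6.4.4] -/
theorem sign_isPolyTime : (scheme f ℓ).sign.IsPolyTime pairCode (id : List Bool → List Bool) := by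
  refine ⟨?_, 0, fun n => (Nat.zero_le _ : (0 : ℕ) ≤ _)⟩
  refine PolyTimeComputable.of_encode (comp_mem_FP (sigFn_mem_FP ℓ) fstF_mem_FP)
    (fun p : (List Bool × List Bool) × List Bool => boolPair (pairCode p.1) p.2) (fun _ => rfl) fun p => ?_
  show sigFn ℓ (fstF (boolPair (boolPair p.1.1 p.1.2) p.2)) = sigOf ℓ p.1.1 p.1.2
  rw [fstF_boolPair, sigFn_apply]

/-- Verification is polynomial-time: the program `verFn`. [Goldreich 2004, Construction 6.4.4; Arora–Barak 2009, §1.3]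
[cite: Goldreich2004, Construction 6.4.4] -/
theorem verify_polyTime (hf : f ∈ FP) :
    PolyTimeComputable SignatureScheme.verifyCode encodeBool
      (fun p : List Bool × List Bool × List Bool => (scheme f ℓ).verify p.1 p.2.1 p.2.2) := by
  refine PolyTimeComputable.of_encode (verFn_mem_FP f ℓ hf) SignatureScheme.verifyCode (fun _ => rfl) fun p => ?_
  show verFn f ℓ (boolPair p.1 (boolPair p.2.1 p.2.2)) = [verifyOf f ℓ p.1 p.2.1 p.2.2]
  exact verFn_apply f ℓ _ _ _

/-- **Construction 6.4.4 is efficient** (`SignatureScheme.IsEfficient`) whenever `f` is polynomial-time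
computable. [Goldreich 2004, Construction 6.4.4 ("a triple (G, S, V) of probabilistic polynomial-time
algorithms")] [cite: Goldreich2004, Construction 6.4.4] -/
theorem isEfficient (hf : f ∈ FP) : (scheme f ℓ).IsEfficient :=
  ⟨keyGen_isPolyTime f ℓ hf, sign_isPolyTime f ℓ, verify_polyTime f ℓ hf⟩

end Programs

end Lamport

end Literature.Computability.Cryptography
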